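import Literature.Barriers.PneNP.TSPExtensionComplexityRothvossAssembly
import HarnessLib

/-!
# One level step is one vertex move: the shell-step identity for the `t`-cuts of a perfect matching

Rothvoß's level classes for the perfect-matching slack matrix [Rothvoß, *The matching polytope has
exponential extension complexity*, J. ACM 64 (2017), §2]: for a perfect matching `M` of `K_n` and a
vertex set `U` with `|U| = t`, the *crossing number* `cc(U,M) = |δ(U) ∩ M|` is the number of
`M`-edges with exactly one endpoint in `U`, and the *shell* `Shell_c(M) = {U : |U| = t, cc(U,M) = c}`
is an orbit of the automorphism group `S₂ ≀ S_{n/2}` of `M` acting on `t`-sets. A level profile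
`φ_M(c) = E_{U ∈ Shell_c(M)} g(U)` of a cut statistic `g` is what an exact extrapolation design
prices (`TracialDesigns.lean`, `ExactDesignRemainder.lean`); its differences in the level `c` are
controlled by the following elementary double count, recorded here in the kernel (cell
`pnp-psdrank`, LIT-43 §2(b)).

Write `π` for the partner map of `M` (a fixed-point-free involution of the vertex set); for a
vertex set `U` put `half(U) = {v ∈ U : π v ∉ U}` (so `|half(U)| = cc(U,M)`),
`full(U) = {v ∈ U : π v ∈ U}`, `free(U) = {v ∉ U : π v ∉ U}`. Then

* `|full(U)| + |half(U)| = |U|` and `|half(U)| + |free(U)| = n − |U|` (`card_full_add_card_half`,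
  `card_half_add_card_free`);
* the MOVE `U ↦ U − b + a` with `b ∈ full(U)`, `a ∈ free(U)` keeps `|U|` and raises the crossing
  number by exactly `2`: `half(U − b + a) = half(U) ∪ {a, π b}` (`half_move`, `card_half_move`);
  conversely for `a, h ∈ half(U′)`, `a ≠ h`, the set `U′ − a + π h` has `half = half(U′) ∖ {a, h}`
  (`half_unmove`), and the two constructions are mutually inverse;
* **the shell-step identity** (`shellStep_sum`): for every `g`,
  `(c+2)(c+1) · Σ_{U′ ∈ Shell_{c+2}} g(U′) = Σ_{U ∈ Shell_c} Σ_{b ∈ full(U)} Σ_{a ∈ free(U)} g(U − b + a)`,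
  i.e. the pairs `(U, U′) ∈ Shell_c × Shell_{c+2}` with `|U △ U′| = 2` form a bi-regular relation
  with degrees `(t − c)(n − t − c)` and `(c+2)(c+1)`; in particular (`g ≡ 1`)
  `(c+2)(c+1) · |Shell_{c+2}| = (t−c)(n−t−c) · |Shell_c|` (`shellStep_card`), and the uniform
  average over `Shell_{c+2}` is the uniform average over `Shell_c` of the average over the
  `(t−c)(n−t−c)` moves (`shellStep_avg`);
* the move kernel on a BLOCK STATISTIC `ψ(|U ∩ H|)` (`card_move_inter`, `sum_moves_block`): one level
  step moves `X = |U ∩ H|` by `±1`,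
  `Σ_{b,a} ψ(|(U−b+a) ∩ H|) = (f₀r₀ + f₁r₁)ψ(X) + f₀r₁ψ(X+1) + f₁r₀ψ(X−1)` with the type counts
  `f₁ = |full(U) ∩ H|`, `f₀ = |full(U) ∖ H|`, `r₁ = |free(U) ∩ H|`, `r₀ = |free(U) ∖ H|` (drift
  `f₀r₁ − f₁r₀`); several blocks at once (`blockCount_move`, `sum_moves_blockCount`): for a labelling
  `β` of the vertices the move shifts the block-count vector by `e_{β a} − e_{β b}`, and
  `Σ_{b,a} G(counts(U − b + a)) = Σ_{i,j} f_i r_j G(counts(U) + e_j − e_i)`.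

Everything is stated for an arbitrary fixed-point-free involution `π` of `Fin n` on plain finsets
(§1–§3) and then bridged to the tree's `PMatch n` / `cc` (§4: `cc_eq_card_half`, the partner map of
a perfect matching is a fixed-point-free involution). All PROVED, 0 sorry, no named facts.

## References

* [Rothvoss2017] T. Rothvoß, *The matching polytope has exponential extension complexity*,
  J. ACM 64 (2017), §2 (PDF pp. 5–6): the cuts `U`, matchings `M`, `|δ(U) ∩ M|` and the level sets
  `Q_ℓ`.
* [GodsilMeagher2015] C. Godsil, K. Meagher, *Erdős–Ko–Rado Theorems: Algebraic Approaches*, CUP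
  2015, §15.2 (perfect matchings of `K_{2m}`, the partner of a vertex, the wreath-product symmetry).
-/

noncomputable section

open Finset

namespace Literature.Combinatorics.Optimization

namespace ShellStep

variable {n : ℕ} (π : Fin n → Fin n)

/-! ### §1 Half-matched, fully-matched and free vertices -/

/-- The half-matched vertices of `U`: `v ∈ U` whose partner is outside `U` (the `U`-endpoints of the
crossing edges `δ(U) ∩ M`). [cite: Rothvoss2017, §2 (PDF p. 5)] -/
def half (U : Finset (Fin n)) : Finset (Fin n) := U.filter fun v => π v ∉ U

/-- The fully-matched vertices of `U`: `v ∈ U` whose partner is inside `U`.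
[cite: Rothvoss2017, §2 (PDF p. 5)] -/
def full (U : Finset (Fin n)) : Finset (Fin n) := U.filter fun v => π v ∈ U

/-- The free vertices: `v ∉ U` whose partner is also outside `U` (endpoints of the edges untouched by
`U`). [cite: Rothvoss2017, §2 (PDF p. 5)] -/
def free (U : Finset (Fin n)) : Finset (Fin n) := Uᶜ.filter fun v => π v ∉ U

/-- The shell `Shell_c = {U : |U| = t, |half(U)| = c}` (Rothvoß's `Q_c` at a fixed matching).
[cite: Rothvoss2017, §2 (PDF p. 6)] -/
def shell (t c : ℕ) : Finset (Finset (Fin n)) := univ.filter fun U => U.card = t ∧ (half π U).card = c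

/-- The move `U − b + a`. [cite: GodsilMeagher2015, §15.2] -/
def move (U : Finset (Fin n)) (b a : Fin n) : Finset (Fin n) := insert a (U.erase b)

/-- The forward triples `(U, b, a)`: `U ∈ Shell_c`, `b ∈ full(U)`, `a ∈ free(U)`.
[cite: Rothvoss2017, §2 (PDF p. 6)] -/
def fwdTriples (t c : ℕ) : Finset (Finset (Fin n) × Fin n × Fin n) :=
  (shell π t c ×ˢ (univ ×ˢ univ)).filter fun x => x.2.1 ∈ full π x.1 ∧ x.2.2 ∈ free π x.1

/-- The backward triples `(U′, a, h)`: `U′ ∈ Shell_{c+2}`, `a ≠ h` both in `half(U′)`.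
[cite: Rothvoss2017, §2 (PDF p. 6)] -/
def bwdTriples (t c : ℕ) : Finset (Finset (Fin n) × Fin n × Fin n) :=
  (shell π t (c + 2) ×ˢ (univ ×ˢ univ)).filter
    fun x => x.2.1 ∈ half π x.1 ∧ x.2.2 ∈ half π x.1 ∧ x.2.1 ≠ x.2.2

variable {π}

/-- Membership in `half`. [cite: Rothvoss2017, §2 (PDF p. 5)] -/
@[simp] theorem mem_half {U : Finset (Fin n)} {v : Fin n} : v ∈ half π U ↔ v ∈ U ∧ π v ∉ U := by
  simp [half]

/-- Membership in `full`. [cite: Rothvoss2017, §2 (PDF p. 5)] -/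
@[simp] theorem mem_full {U : Finset (Fin n)} {v : Fin n} : v ∈ full π U ↔ v ∈ U ∧ π v ∈ U := by
  simp [full]

/-- Membership in `free`. [cite: Rothvoss2017, §2 (PDF p. 5)] -/
@[simp] theorem mem_free {U : Finset (Fin n)} {v : Fin n} : v ∈ free π U ↔ v ∉ U ∧ π v ∉ U := by
  simp [free]

/-- Membership in the shell. [cite: Rothvoss2017, §2 (PDF p. 6)] -/
@[simp] theorem mem_shell {t c : ℕ} {U : Finset (Fin n)} :
    U ∈ shell π t c ↔ U.card = t ∧ (half π U).card = c := by
  simp [shell]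

/-- Membership in `U − b + a`. [cite: GodsilMeagher2015, §15.2] -/
@[simp] theorem mem_move {U : Finset (Fin n)} {b a v : Fin n} :
    v ∈ move U b a ↔ v = a ∨ (v ≠ b ∧ v ∈ U) := by
  simp [move]

/-- Membership in `fwdTriples`. [cite: Rothvoss2017, §2 (PDF p. 6)] -/
@[simp] theorem mem_fwdTriples {t c : ℕ} {x : Finset (Fin n) × Fin n × Fin n} :
    x ∈ fwdTriples π t c ↔ x.1 ∈ shell π t c ∧ x.2.1 ∈ full π x.1 ∧ x.2.2 ∈ free π x.1 := by
  simp [fwdTriples]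

/-- Membership in `bwdTriples`. [cite: Rothvoss2017, §2 (PDF p. 6)] -/
@[simp] theorem mem_bwdTriples {t c : ℕ} {x : Finset (Fin n) × Fin n × Fin n} :
    x ∈ bwdTriples π t c ↔
      x.1 ∈ shell π t (c + 2) ∧ x.2.1 ∈ half π x.1 ∧ x.2.2 ∈ half π x.1 ∧ x.2.1 ≠ x.2.2 := by
  simp [bwdTriples]

/-- The move keeps the size: `|U − b + a| = |U|`. [cite: GodsilMeagher2015, §15.2] -/
theorem card_move {U : Finset (Fin n)} {b a : Fin n} (hb : b ∈ U) (ha : a ∉ U) :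
    (move U b a).card = U.card := by
  rw [move, card_insert_of_notMem (fun h => ha (mem_of_mem_erase h)), card_erase_of_mem hb]
  have : 0 < U.card := card_pos.2 ⟨b, hb⟩
  omega

/-- `half(U) ⊆ U`. [cite: Rothvoss2017, §2 (PDF p. 5)] -/
theorem half_subset (U : Finset (Fin n)) : half π U ⊆ U := filter_subset _ _

/-- `|full(U)| + |half(U)| = |U|`. [cite: Rothvoss2017, §2 (PDF p. 5)] -/
theorem card_full_add_card_half (U : Finset (Fin n)) :
    (full π U).card + (half π U).card = U.card :=
  card_filter_add_card_filter_not _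

section Involution

variable (hπ : ∀ v, π (π v) = v)
include hπ

/-- `π` is injective. [cite: GodsilMeagher2015, §15.2] -/
theorem π_injective : Function.Injective π := fun a b h => by rw [← hπ a, h, hπ]

/-- `π v = w ↔ v = π w`. [cite: GodsilMeagher2015, §15.2] -/
theorem π_eq_iff {v w : Fin n} : π v = w ↔ v = π w := by
  constructor
  · rintro rfl; rw [hπ]
  · rintro rfl; rw [hπ]

/-- The outside vertices with partner inside are the partners of the half-matched vertices.
[cite: Rothvoss2017, §2 (PDF p. 5)] -/
theorem compl_filter_eq_image_half (U : Finset (Fin n)) :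
    Uᶜ.filter (fun v => π v ∈ U) = (half π U).image π := by
  ext v
  simp only [mem_filter, mem_compl, mem_image, mem_half]
  constructor
  · rintro ⟨hv, hπv⟩
    exact ⟨π v, ⟨hπv, by rwa [hπ]⟩, hπ v⟩
  · rintro ⟨w, ⟨hw, hπw⟩, rfl⟩
    exact ⟨hπw, by rwa [hπ]⟩

/-- `|half(U)| + |free(U)| = n − |U|`. [cite: Rothvoss2017, §2 (PDF p. 5)] -/
theorem card_half_add_card_free (U : Finset (Fin n)) :
    (half π U).card + (free π U).card = n - U.card := by
  have h1 : (Uᶜ.filter fun v => π v ∈ U).card = (half π U).card := by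
    rw [compl_filter_eq_image_half hπ, card_image_of_injective _ (π_injective hπ)]
  have h2 := card_filter_add_card_filter_not (s := Uᶜ) (fun v => π v ∈ U)
  rw [h1, card_compl, Fintype.card_fin] at h2
  exact h2

omit hπ in
/-- `|full(U)| = t − c` on the shell. [cite: Rothvoss2017, §2 (PDF p. 6)] -/
theorem card_full_of_mem_shell {t c : ℕ} {U : Finset (Fin n)} (hU : U ∈ shell π t c) :
    (full π U).card = t - c := by
  obtain ⟨ht, hc⟩ := mem_shell.1 hU
  have := card_full_add_card_half (π := π) U
  omega

/-- `|free(U)| = n − t − c` on the shell. [cite: Rothvoss2017, §2 (PDF p. 6)] -/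
theorem card_free_of_mem_shell {t c : ℕ} {U : Finset (Fin n)} (hU : U ∈ shell π t c) :
    (free π U).card = n - t - c := by
  obtain ⟨ht, hc⟩ := mem_shell.1 hU
  have := card_half_add_card_free hπ U
  omega

variable (hπ' : ∀ v, π v ≠ v)
include hπ'

/-! ### §2 The move raises the crossing number by two -/

/-- **Half-matched vertices after a move**: for `b ∈ full(U)` and `a ∈ free(U)`,
`half(U − b + a) = half(U) ∪ {π b, a}`. [cite: Rothvoss2017, §2 (PDF p. 5)] -/
theorem half_move {U : Finset (Fin n)} {b a : Fin n} (hb : b ∈ full π U) (ha : a ∈ free π U) :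
    half π (move U b a) = insert a (insert (π b) (half π U)) := by
  obtain ⟨hbU, hπb⟩ := mem_full.1 hb
  obtain ⟨haU, hπa⟩ := mem_free.1 ha
  have hab : a ≠ b := fun h => haU (h ▸ hbU)
  have hπbb : π b ≠ b := hπ' b
  have hπba : π b ≠ a := fun h => haU (h ▸ hπb)
  have hπaa : π a ≠ a := hπ' a
  ext v
  simp only [mem_half, mem_move, mem_insert, not_or, not_and]
  constructor
  · rintro ⟨hv | ⟨hvb, hvU⟩, hπva, h2⟩
    · exact Or.inl hv
    · -- `v ∈ U`, `v ≠ b`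
      by_cases hvπb : v = π b
      · exact Or.inr (Or.inl hvπb)
      · refine Or.inr (Or.inr ⟨hvU, fun hπvU => ?_⟩)
        have hπvb : π v ≠ b := fun h => hvπb ((π_eq_iff hπ).1 h)
        exact absurd hπvU (by have := h2 hπvb; exact this)
  · rintro (rfl | rfl | ⟨hvU, hπvU⟩)
    · exact ⟨Or.inl rfl, hπaa, fun _ => hπa⟩
    · refine ⟨Or.inr ⟨hπbb, hπb⟩, ?_, fun h => ?_⟩
      · rw [hπ]; exact hab.symm
      · exact absurd (hπ b) h
    · have hvb : v ≠ b := fun h => hπvU (h ▸ hπb)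
      have hπva : π v ≠ a := fun h => by
        have : v = π a := (π_eq_iff hπ).1 h
        exact hπa (this ▸ hvU)
      exact ⟨Or.inr ⟨hvb, hvU⟩, hπva, fun _ => hπvU⟩

/-- Hence `|half(U − b + a)| = |half(U)| + 2`. [cite: Rothvoss2017, §2 (PDF p. 5)] -/
theorem card_half_move {U : Finset (Fin n)} {b a : Fin n} (hb : b ∈ full π U) (ha : a ∈ free π U) :
    (half π (move U b a)).card = (half π U).card + 2 := by
  obtain ⟨hbU, hπb⟩ := mem_full.1 hb
  obtain ⟨haU, hπa⟩ := mem_free.1 ha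
  rw [half_move hπ hπ' hb ha, card_insert_of_notMem, card_insert_of_notMem]
  · simp only [mem_half, not_and, not_not]
    exact fun _ => by rw [hπ]; exact hbU
  · simp only [mem_insert, mem_half, not_or]
    exact ⟨fun h => haU (h ▸ hπb), fun h => haU h.1⟩

/-- The move maps `Shell_c` into `Shell_{c+2}`. [cite: Rothvoss2017, §2 (PDF p. 6)] -/
theorem move_mem_shell {t c : ℕ} {U : Finset (Fin n)} (hU : U ∈ shell π t c) {b a : Fin n}
    (hb : b ∈ full π U) (ha : a ∈ free π U) : move U b a ∈ shell π t (c + 2) := by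
  obtain ⟨ht, hc⟩ := mem_shell.1 hU
  exact mem_shell.2 ⟨by rw [card_move (mem_full.1 hb).1 (mem_free.1 ha).1, ht],
    by rw [card_half_move hπ hπ' hb ha, hc]⟩

/-- **Half-matched vertices after the reverse move**: for `a, h ∈ half(U′)`, `a ≠ h`,
`half(U′ − a + π h) = half(U′) ∖ {a, h}`. [cite: Rothvoss2017, §2 (PDF p. 5)] -/
theorem half_unmove {U' : Finset (Fin n)} {a h : Fin n} (ha : a ∈ half π U') (hh : h ∈ half π U')
    (hah : a ≠ h) : half π (move U' a (π h)) = ((half π U').erase a).erase h := by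
  obtain ⟨haU, hπa⟩ := mem_half.1 ha
  obtain ⟨hhU, hπh⟩ := mem_half.1 hh
  have hπha : π h ≠ a := fun e => hπh (e ▸ haU)
  have hπhh : π h ≠ h := hπ' h
  ext v
  simp only [mem_half, mem_move, mem_erase, not_or, not_and]
  constructor
  · rintro ⟨hv | ⟨hva, hvU⟩, hπvπh, h2⟩
    · -- v = π h : then π v = h ∈ U', contradiction with h2
      subst hv
      rw [hπ] at hπvπh h2
      exact absurd hhU (h2 hah.symm)
    · have hvh : v ≠ h := fun e => hπvπh (by rw [e])
      refine ⟨hvh, hva, hvU, fun hπvU => ?_⟩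
      have hπva : π v ≠ a := fun e => by
        have : v = π a := (π_eq_iff hπ).1 e
        exact hπa (this ▸ hvU)
      exact absurd hπvU (h2 hπva)
  · rintro ⟨hvh, hva, hvU, hπvU⟩
    refine ⟨Or.inr ⟨hva, hvU⟩, fun e => hvh (π_injective hπ e), fun _ => hπvU⟩

/-- The reverse move lands in `Shell_c`: `|half(U′ − a + π h)| + 2 = |half(U′)|`, `|U′ − a + π h| = |U′|`.
[cite: Rothvoss2017, §2 (PDF p. 6)] -/
theorem unmove_mem_shell {t c : ℕ} {U' : Finset (Fin n)} (hU' : U' ∈ shell π t (c + 2)) {a h : Fin n}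
    (ha : a ∈ half π U') (hh : h ∈ half π U') (hah : a ≠ h) : move U' a (π h) ∈ shell π t c := by
  obtain ⟨ht, hc⟩ := mem_shell.1 hU'
  obtain ⟨haU, hπa⟩ := mem_half.1 ha
  obtain ⟨hhU, hπh⟩ := mem_half.1 hh
  refine mem_shell.2 ⟨by rw [card_move haU hπh, ht], ?_⟩
  rw [half_unmove hπ hπ' ha hh hah, card_erase_of_mem (mem_erase.2 ⟨hah.symm, hh⟩),
    card_erase_of_mem ha, hc]
  omega

/-! ### §3 The shell-step identity -/

/-- **The move is a bijection** `fwdTriples ≃ bwdTriples`, `(U,b,a) ↦ (U − b + a, a, π b)`, with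
inverse `(U′,a,h) ↦ (U′ − a + π h, π h, a)`; as a sum identity:
`Σ_{(U,b,a)} F(U − b + a, a, π b) = Σ_{(U′,a,h)} F(U′,a,h)`. [cite: Rothvoss2017, §2 (PDF p. 6)] -/
theorem sum_fwdTriples_eq_sum_bwdTriples (t c : ℕ) (F : Finset (Fin n) × Fin n × Fin n → ℝ) :
    ∑ x ∈ fwdTriples π t c, F (move x.1 x.2.1 x.2.2, x.2.2, π x.2.1) = ∑ y ∈ bwdTriples π t c, F y := by
  refine sum_nbij' (fun x => (move x.1 x.2.1 x.2.2, x.2.2, π x.2.1))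
    (fun y => (move y.1 y.2.1 (π y.2.2), π y.2.2, y.2.1)) ?_ ?_ ?_ ?_ fun _ _ => rfl
  · -- forward lands in `bwdTriples`
    rintro ⟨U, b, a⟩ hx
    obtain ⟨hU, hb, ha⟩ := mem_fwdTriples.1 hx
    obtain ⟨hbU, hπb⟩ := mem_full.1 hb
    obtain ⟨haU, hπa⟩ := mem_free.1 ha
    refine mem_bwdTriples.2 ⟨move_mem_shell hπ hπ' hU hb ha, ?_, ?_, ?_⟩
    · rw [half_move hπ hπ' hb ha]; exact mem_insert_self _ _
    · rw [half_move hπ hπ' hb ha]; exact mem_insert_of_mem (mem_insert_self _ _)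
    · show a ≠ π b
      exact fun h => haU (by rw [h]; exact hπb)
  · -- backward lands in `fwdTriples`
    rintro ⟨U', a, h⟩ hy
    obtain ⟨hU', ha, hh, hah⟩ := mem_bwdTriples.1 hy
    obtain ⟨haU, hπa⟩ := mem_half.1 ha
    obtain ⟨hhU, hπh⟩ := mem_half.1 hh
    have hπha : π h ≠ a := fun e => hπh (e ▸ haU)
    refine mem_fwdTriples.2 ⟨unmove_mem_shell hπ hπ' hU' ha hh hah, ?_, ?_⟩
    · refine mem_full.2 ⟨mem_move.2 (Or.inl rfl), ?_⟩
      rw [hπ]; exact mem_move.2 (Or.inr ⟨hah.symm, hhU⟩)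
    · refine mem_free.2 ⟨?_, ?_⟩
      · rw [mem_move, not_or]; exact ⟨hπha.symm, fun h' => h'.1 rfl⟩
      · rw [mem_move, not_or]
        exact ⟨fun e => hah (π_injective hπ e), fun h' => hπa h'.2⟩
  · -- left inverse
    rintro ⟨U, b, a⟩ hx
    obtain ⟨hU, hb, ha⟩ := mem_fwdTriples.1 hx
    obtain ⟨hbU, hπb⟩ := mem_full.1 hb
    obtain ⟨haU, hπa⟩ := mem_free.1 ha
    have h1 : a ∉ U.erase b := fun h => haU (mem_of_mem_erase h)
    simp only [hπ, move, erase_insert h1, insert_erase hbU]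
  · -- right inverse
    rintro ⟨U', a, h⟩ hy
    obtain ⟨hU', ha, hh, hah⟩ := mem_bwdTriples.1 hy
    obtain ⟨haU, hπa⟩ := mem_half.1 ha
    obtain ⟨hhU, hπh⟩ := mem_half.1 hh
    have h1 : π h ∉ U'.erase a := fun h' => hπh (mem_of_mem_erase h')
    simp only [hπ, move, erase_insert h1, insert_erase haU]

omit hπ hπ' in
/-- Iterated form of the forward sum. [cite: Rothvoss2017, §2 (PDF p. 6)] -/
theorem sum_fwdTriples_eq (t c : ℕ) (G : Finset (Fin n) × Fin n × Fin n → ℝ) :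
    ∑ x ∈ fwdTriples π t c, G x = ∑ U ∈ shell π t c, ∑ b ∈ full π U, ∑ a ∈ free π U, G (U, b, a) := by
  rw [fwdTriples, sum_filter, sum_product]
  refine sum_congr rfl fun U _ => ?_
  rw [sum_product]
  rw [← sum_filter_add_sum_filter_not univ (fun b => b ∈ full π U)]
  rw [filter_univ_mem, sum_eq_zero (s := univ.filter fun b => b ∉ full π U) fun b hb => by
    rw [mem_filter] at hb; exact sum_eq_zero fun a _ => if_neg fun h => hb.2 h.1, add_zero]
  refine sum_congr rfl fun b hb => ?_
  rw [← sum_filter_add_sum_filter_not univ (fun a => a ∈ free π U), filter_univ_mem,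
    sum_eq_zero (s := univ.filter fun a => a ∉ free π U) fun a ha' => by
      rw [mem_filter] at ha'; exact if_neg fun h => ha'.2 h.2, add_zero]
  exact sum_congr rfl fun a ha => if_pos ⟨hb, ha⟩

omit hπ hπ' in
/-- Iterated form of the backward sum: `Σ_{(U′,a,h)} g(U′) = (c+2)(c+1) Σ_{U′} g(U′)`.
[cite: Rothvoss2017, §2 (PDF p. 6)] -/
theorem sum_bwdTriples_eq (t c : ℕ) (g : Finset (Fin n) → ℝ) :
    ∑ y ∈ bwdTriples π t c, g y.1 = ((c + 2) * (c + 1) : ℝ) * ∑ U' ∈ shell π t (c + 2), g U' := by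
  rw [bwdTriples, sum_filter, sum_product, mul_sum]
  refine sum_congr rfl fun U' hU' => ?_
  obtain ⟨_, hc⟩ := mem_shell.1 hU'
  have hcount : ∑ y ∈ (univ : Finset (Fin n)) ×ˢ (univ : Finset (Fin n)),
      (if y.1 ∈ half π U' ∧ y.2 ∈ half π U' ∧ y.1 ≠ y.2 then (1 : ℝ) else 0) = (c + 2) * (c + 1) := by
    rw [← sum_filter, sum_const, nsmul_eq_mul, mul_one]
    have : ((univ : Finset (Fin n)) ×ˢ (univ : Finset (Fin n))).filter
        (fun y => y.1 ∈ half π U' ∧ y.2 ∈ half π U' ∧ y.1 ≠ y.2) = (half π U').offDiag := by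
      ext y; simp [mem_offDiag]
    rw [this, offDiag_card, hc]
    have h2 : (c + 2) ≤ (c + 2) * (c + 2) := Nat.le_mul_self _
    push_cast [Nat.cast_sub h2]
    ring
  calc ∑ y ∈ (univ : Finset (Fin n)) ×ˢ (univ : Finset (Fin n)),
        (if (U', y).2.1 ∈ half π (U', y).1 ∧ (U', y).2.2 ∈ half π (U', y).1 ∧ (U', y).2.1 ≠ (U', y).2.2
          then g (U', y).1 else 0)
      = ∑ y ∈ (univ : Finset (Fin n)) ×ˢ (univ : Finset (Fin n)),
          g U' * (if y.1 ∈ half π U' ∧ y.2 ∈ half π U' ∧ y.1 ≠ y.2 then (1 : ℝ) else 0) :=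
        sum_congr rfl fun y _ => by split_ifs <;> simp
    _ = g U' * ((c + 2) * (c + 1)) := by rw [← mul_sum, hcount]
    _ = (c + 2) * (c + 1) * g U' := by ring

/-- **The shell-step identity** (one level step = one vertex move): for every cut statistic `g`,
`(c+2)(c+1) · Σ_{U′ ∈ Shell_{c+2}} g(U′) = Σ_{U ∈ Shell_c} Σ_{b ∈ full(U)} Σ_{a ∈ free(U)} g(U − b + a)`.
[cite: Rothvoss2017, §2 (PDF p. 6)] -/
theorem shellStep_sum (t c : ℕ) (g : Finset (Fin n) → ℝ) :
    ((c + 2) * (c + 1) : ℝ) * ∑ U' ∈ shell π t (c + 2), g U' =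
      ∑ U ∈ shell π t c, ∑ b ∈ full π U, ∑ a ∈ free π U, g (move U b a) := by
  rw [← sum_bwdTriples_eq, ← sum_fwdTriples_eq_sum_bwdTriples hπ hπ' t c (fun y => g y.1),
    sum_fwdTriples_eq]

/-- **Bi-regularity of adjacent shells**: `(c+2)(c+1) · |Shell_{c+2}| = (t−c)(n−t−c) · |Shell_c|`.
[cite: Rothvoss2017, §2 (PDF p. 6)] -/
theorem shellStep_card (t c : ℕ) :
    ((c + 2) * (c + 1) : ℝ) * (shell π t (c + 2)).card = ((t - c) * (n - t - c) : ℝ) * (shell π t c).card := by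
  have h := shellStep_sum hπ hπ' t c (fun _ => (1 : ℝ))
  simp only [sum_const, nsmul_eq_mul, mul_one] at h
  rw [h, show ((t - c) * (n - t - c) : ℝ) * (shell π t c).card = ∑ U ∈ shell π t c, ((t - c) * (n - t - c) : ℝ) by
    rw [sum_const, nsmul_eq_mul]; ring]
  refine sum_congr rfl fun U hU => ?_
  obtain ⟨ht, hc⟩ := mem_shell.1 hU
  have h1 := card_full_add_card_half (π := π) U
  have h2 := card_half_add_card_free hπ U
  have h3 : U.card ≤ n := by simpa using card_le_univ U
  rw [card_full_of_mem_shell hU, card_free_of_mem_shell hπ hU, Nat.cast_sub (by omega),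
    Nat.cast_sub (by omega), Nat.cast_sub (by omega)]

/-- **Shell averages by moves**: if `Shell_c ≠ ∅`, `c + 1 ≤ t` and `t + c + 1 ≤ n` (so every `U` has a
move), the uniform average of `g` over `Shell_{c+2}` is the uniform average over `U ∈ Shell_c` of the
average of `g(U − b + a)` over the `(t−c)(n−t−c)` moves. [cite: Rothvoss2017, §2 (PDF p. 6)] -/
theorem shellStep_avg {t c : ℕ} (hne : (shell π t c).Nonempty) (hct : c + 1 ≤ t) (hn : t + c + 1 ≤ n)
    (g : Finset (Fin n) → ℝ) :
    (∑ U' ∈ shell π t (c + 2), g U') / (shell π t (c + 2)).card =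
      (∑ U ∈ shell π t c, (∑ b ∈ full π U, ∑ a ∈ free π U, g (move U b a)) / ((t - c) * (n - t - c) : ℝ)) /
        (shell π t c).card := by
  have hD : (0 : ℝ) < ((t - c) * (n - t - c) : ℝ) := by
    have h1 : (c : ℝ) + 1 ≤ t := by exact_mod_cast hct
    have h2 : (t : ℝ) + c + 1 ≤ n := by exact_mod_cast hn
    exact mul_pos (by linarith) (by linarith)
  have hK : (0 : ℝ) < ((c + 2) * (c + 1) : ℝ) := by positivity
  have hS : (0 : ℝ) < (shell π t c).card := by exact_mod_cast hne.card_pos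
  have hcard := shellStep_card hπ hπ' t c
  have hsum := shellStep_sum hπ hπ' t c g
  have hS2 : ((shell π t (c + 2)).card : ℝ) = ((t - c) * (n - t - c) : ℝ) * (shell π t c).card / ((c + 2) * (c + 1) : ℝ) := by
    rw [← hcard]; field_simp
  have hsig : ∑ U' ∈ shell π t (c + 2), g U' =
      (∑ U ∈ shell π t c, ∑ b ∈ full π U, ∑ a ∈ free π U, g (move U b a)) / ((c + 2) * (c + 1) : ℝ) := by
    rw [← hsum]; field_simp
  rw [← sum_div, hS2, hsig]
  field_simp

end Involution

/-! ### §3b Block statistics under the move: one level step is a `±1` step of `|U ∩ H|` -/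

/-- The block count after a move: `|(U − b + a) ∩ H| = |U ∩ H| + [a ∈ H] − [b ∈ H]` (as integers).
[cite: Rothvoss2017, §2 (PDF p. 5)] -/
theorem card_move_inter (U H : Finset (Fin n)) {b a : Fin n} (hb : b ∈ U) (ha : a ∉ U) :
    (((move U b a ∩ H).card : ℕ) : ℤ) =
      (U ∩ H).card + (if a ∈ H then 1 else 0) - (if b ∈ H then 1 else 0) := by
  have h1 : move U b a ∩ H = insert a (U.erase b) ∩ H := rfl
  rw [h1]
  by_cases haH : a ∈ H <;> by_cases hbH : b ∈ H
  · rw [insert_inter_of_mem haH, erase_inter, card_insert_of_notMem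
        (fun h => ha (mem_inter.1 (mem_of_mem_erase h)).1),
      card_erase_of_mem (mem_inter.2 ⟨hb, hbH⟩), if_pos haH, if_pos hbH]
    have : 0 < (U ∩ H).card := card_pos.2 ⟨b, mem_inter.2 ⟨hb, hbH⟩⟩
    push_cast [Nat.cast_sub this]
    ring
  · rw [insert_inter_of_mem haH, erase_inter, erase_eq_of_notMem (fun h => hbH (mem_inter.1 h).2),
      card_insert_of_notMem (fun h => ha (mem_inter.1 h).1), if_pos haH, if_neg hbH]
    push_cast
    ring
  · rw [insert_inter_of_notMem haH, erase_inter, card_erase_of_mem (mem_inter.2 ⟨hb, hbH⟩), if_neg haH,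
      if_pos hbH]
    have : 0 < (U ∩ H).card := card_pos.2 ⟨b, mem_inter.2 ⟨hb, hbH⟩⟩
    push_cast [Nat.cast_sub this]
    ring
  · rw [insert_inter_of_notMem haH, erase_inter, erase_eq_of_notMem (fun h => hbH (mem_inter.1 h).2),
      if_neg haH, if_neg hbH]
    ring

/-- **The move kernel on a block statistic** `ψ(|U ∩ H|)`: summed over the `|full(U)|·|free(U)|` moves,
`Σ_{b ∈ full(U)} Σ_{a ∈ free(U)} ψ(|(U−b+a) ∩ H|) = (f₀r₀ + f₁r₁) ψ(X) + f₀r₁ ψ(X+1) + f₁r₀ ψ(X−1)`,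
where `X = |U ∩ H|`, `f₁ = |full(U) ∩ H|`, `f₀ = |full(U) ∖ H|`, `r₁ = |free(U) ∩ H|`,
`r₀ = |free(U) ∖ H|` — one level step moves `X` by `±1` with these type counts (the drift is
`f₀r₁ − f₁r₀`). [cite: Rothvoss2017, §2 (PDF p. 6)] -/
theorem sum_moves_block (U H : Finset (Fin n)) (ψ : ℕ → ℝ) :
    ∑ b ∈ full π U, ∑ a ∈ free π U, ψ ((move U b a ∩ H).card) =
      (((full π U \ H).card * (free π U \ H).card + (full π U ∩ H).card * (free π U ∩ H).card : ℕ) : ℝ) *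
          ψ ((U ∩ H).card)
        + (((full π U \ H).card * (free π U ∩ H).card : ℕ) : ℝ) * ψ ((U ∩ H).card + 1)
        + (((full π U ∩ H).card * (free π U \ H).card : ℕ) : ℝ) * ψ ((U ∩ H).card - 1) := by
  -- the value of the summand in the four blocks
  have hval : ∀ b ∈ full π U, ∀ a ∈ free π U, (move U b a ∩ H).card =
      if a ∈ H then (if b ∈ H then (U ∩ H).card else (U ∩ H).card + 1)
      else (if b ∈ H then (U ∩ H).card - 1 else (U ∩ H).card) := by
    intro b hb a ha
    have hbU : b ∈ U := (mem_full.1 hb).1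
    have haU : a ∉ U := (mem_free.1 ha).1
    have h := card_move_inter U H hbU haU
    by_cases haH : a ∈ H <;> by_cases hbH : b ∈ H <;> simp only [haH, hbH, if_true, if_false] at h ⊢
    · omega
    · omega
    · have : 0 < (U ∩ H).card := card_pos.2 ⟨b, mem_inter.2 ⟨hbU, hbH⟩⟩
      omega
    · omega
  -- split both sums along `H`
  have hsplit : ∀ (s : Finset (Fin n)) (F : Fin n → ℝ),
      ∑ x ∈ s, F x = ∑ x ∈ s ∩ H, F x + ∑ x ∈ s \ H, F x := fun s F => by
    rw [← sum_filter_add_sum_filter_not s (fun x => x ∈ H), filter_mem_eq_inter]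
    congr 1
    refine sum_congr ?_ fun _ _ => rfl
    ext x; simp [mem_sdiff]
  rw [hsplit (full π U)]
  rw [sum_congr rfl fun b hb => hsplit (free π U) (fun a => ψ ((move U b a ∩ H).card))]
  rw [sum_congr rfl fun b hb => hsplit (free π U) (fun a => ψ ((move U b a ∩ H).card))]
  rw [sum_add_distrib, sum_add_distrib]
  -- evaluate the four constant blocks
  have e11 : ∑ b ∈ full π U ∩ H, ∑ a ∈ free π U ∩ H, ψ ((move U b a ∩ H).card) =
      (((full π U ∩ H).card * (free π U ∩ H).card : ℕ) : ℝ) * ψ ((U ∩ H).card) := by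
    rw [sum_congr rfl fun b hb => sum_congr rfl fun a ha => by
      rw [hval b (mem_inter.1 hb).1 a (mem_inter.1 ha).1, if_pos (mem_inter.1 ha).2, if_pos (mem_inter.1 hb).2]]
    simp only [sum_const, nsmul_eq_mul, Nat.cast_mul]; ring
  have e10 : ∑ b ∈ full π U ∩ H, ∑ a ∈ free π U \ H, ψ ((move U b a ∩ H).card) =
      (((full π U ∩ H).card * (free π U \ H).card : ℕ) : ℝ) * ψ ((U ∩ H).card - 1) := by
    rw [sum_congr rfl fun b hb => sum_congr rfl fun a ha => by
      rw [hval b (mem_inter.1 hb).1 a (mem_sdiff.1 ha).1, if_neg (mem_sdiff.1 ha).2, if_pos (mem_inter.1 hb).2]]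
    simp only [sum_const, nsmul_eq_mul, Nat.cast_mul]; ring
  have e01 : ∑ b ∈ full π U \ H, ∑ a ∈ free π U ∩ H, ψ ((move U b a ∩ H).card) =
      (((full π U \ H).card * (free π U ∩ H).card : ℕ) : ℝ) * ψ ((U ∩ H).card + 1) := by
    rw [sum_congr rfl fun b hb => sum_congr rfl fun a ha => by
      rw [hval b (mem_sdiff.1 hb).1 a (mem_inter.1 ha).1, if_pos (mem_inter.1 ha).2, if_neg (mem_sdiff.1 hb).2]]
    simp only [sum_const, nsmul_eq_mul, Nat.cast_mul]; ring
  have e00 : ∑ b ∈ full π U \ H, ∑ a ∈ free π U \ H, ψ ((move U b a ∩ H).card) =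
      (((full π U \ H).card * (free π U \ H).card : ℕ) : ℝ) * ψ ((U ∩ H).card) := by
    rw [sum_congr rfl fun b hb => sum_congr rfl fun a ha => by
      rw [hval b (mem_sdiff.1 hb).1 a (mem_sdiff.1 ha).1, if_neg (mem_sdiff.1 ha).2, if_neg (mem_sdiff.1 hb).2]]
    simp only [sum_const, nsmul_eq_mul, Nat.cast_mul]; ring
  rw [e11, e10, e01, e00]
  push_cast
  ring

/-! ### §3c The move kernel on a vector of block counts (several blocks at once) -/

section Blocks

variable {ι : Type*} [DecidableEq ι]

/-- The block of label `l` of a labelling `β` of the vertices. [cite: Rothvoss2017, §2 (PDF p. 5)] -/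
def block (β : Fin n → ι) (l : ι) : Finset (Fin n) := univ.filter fun v => β v = l

/-- Membership in a block. [cite: Rothvoss2017, §2 (PDF p. 5)] -/
@[simp] theorem mem_block {β : Fin n → ι} {l : ι} {v : Fin n} : v ∈ block β l ↔ β v = l := by
  simp [block]

/-- The vector of block counts of `U`: `l ↦ |U ∩ β⁻¹(l)|` (as integers).
[cite: Rothvoss2017, §2 (PDF p. 5)] -/
def blockCount (β : Fin n → ι) (U : Finset (Fin n)) : ι → ℤ := fun l => ((U ∩ block β l).card : ℤ)

/-- **A move shifts the block-count vector by `e_{β a} − e_{β b}`.** [cite: Rothvoss2017, §2 (PDF p. 5)] -/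
theorem blockCount_move (β : Fin n → ι) (U : Finset (Fin n)) {b a : Fin n} (hb : b ∈ U) (ha : a ∉ U) :
    blockCount β (move U b a) = blockCount β U + Pi.single (β a) 1 - Pi.single (β b) 1 := by
  funext l
  simp only [blockCount, Pi.add_apply, Pi.sub_apply, Pi.single_apply]
  rw [card_move_inter U (block β l) hb ha]
  have e1 : (a ∈ block β l) ↔ (l = β a) := by rw [mem_block, eq_comm]
  have e2 : (b ∈ block β l) ↔ (l = β b) := by rw [mem_block, eq_comm]
  simp only [e1, e2]

/-- A filter by label is an intersection with the block. [cite: Rothvoss2017, §2 (PDF p. 5)] -/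
theorem filter_label_eq (β : Fin n → ι) (s : Finset (Fin n)) (l : ι) :
    (s.filter fun v => β v = l) = s ∩ block β l := by
  ext v; simp [block]

/-- **The move kernel on block counts**: for any function `G` of the block-count vector,
`Σ_{b ∈ full(U)} Σ_{a ∈ free(U)} G(counts(U − b + a)) = Σ_{i,j} f_i r_j · G(counts(U) + e_j − e_i)`
with `f_i = |full(U) ∩ β⁻¹(i)|`, `r_j = |free(U) ∩ β⁻¹(j)|` — one level step is a single
`(i → j)` transfer of one unit of block count, with rate `f_i r_j`. (Balanced slabs: `ι = Fin 3`
labels `H₁, H₂, rest`, `G = g(X₁ − X₂)`.) [cite: Rothvoss2017, §2 (PDF p. 6)] -/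
theorem sum_moves_blockCount [Fintype ι] (β : Fin n → ι) (U : Finset (Fin n)) (G : (ι → ℤ) → ℝ) :
    ∑ b ∈ full π U, ∑ a ∈ free π U, G (blockCount β (move U b a)) =
      ∑ i, ∑ j, (((full π U ∩ block β i).card * (free π U ∩ block β j).card : ℕ) : ℝ) *
        G (blockCount β U + Pi.single j 1 - Pi.single i 1) := by
  calc ∑ b ∈ full π U, ∑ a ∈ free π U, G (blockCount β (move U b a))
      = ∑ b ∈ full π U, ∑ a ∈ free π U,
          G (blockCount β U + Pi.single (β a) 1 - Pi.single (β b) 1) :=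
        sum_congr rfl fun b hb => sum_congr rfl fun a ha => by
          rw [blockCount_move β U (mem_full.1 hb).1 (mem_free.1 ha).1]
    _ = ∑ b ∈ full π U, ∑ j, ∑ a ∈ free π U with β a = j,
          G (blockCount β U + Pi.single j 1 - Pi.single (β b) 1) :=
        sum_congr rfl fun b _ =>
          (sum_fiberwise' (free π U) β fun j => G (blockCount β U + Pi.single j 1 - Pi.single (β b) 1)).symm
    _ = ∑ b ∈ full π U, ∑ j, (((free π U ∩ block β j).card : ℕ) : ℝ) *
          G (blockCount β U + Pi.single j 1 - Pi.single (β b) 1) :=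
        sum_congr rfl fun b _ => sum_congr rfl fun j _ => by
          rw [sum_const, nsmul_eq_mul, filter_label_eq]
    _ = ∑ j, ∑ b ∈ full π U, (((free π U ∩ block β j).card : ℕ) : ℝ) *
          G (blockCount β U + Pi.single j 1 - Pi.single (β b) 1) := sum_comm
    _ = ∑ j, ∑ i, ∑ b ∈ full π U with β b = i, (((free π U ∩ block β j).card : ℕ) : ℝ) *
          G (blockCount β U + Pi.single j 1 - Pi.single i 1) :=
        sum_congr rfl fun j _ =>
          (sum_fiberwise' (full π U) β fun i => (((free π U ∩ block β j).card : ℕ) : ℝ) *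
            G (blockCount β U + Pi.single j 1 - Pi.single i 1)).symm
    _ = ∑ j, ∑ i, (((full π U ∩ block β i).card : ℕ) : ℝ) *
          ((((free π U ∩ block β j).card : ℕ) : ℝ) * G (blockCount β U + Pi.single j 1 - Pi.single i 1)) :=
        sum_congr rfl fun j _ => sum_congr rfl fun i _ => by
          rw [sum_const, nsmul_eq_mul, filter_label_eq]
    _ = ∑ i, ∑ j, (((full π U ∩ block β i).card * (free π U ∩ block β j).card : ℕ) : ℝ) *
          G (blockCount β U + Pi.single j 1 - Pi.single i 1) := by
        rw [sum_comm]
        refine sum_congr rfl fun i _ => sum_congr rfl fun j _ => ?_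
        push_cast
        ring

end Blocks

end ShellStep

/-! ### §4 Bridge to the tree's perfect matchings `PMatch n` and crossing number `cc` -/

namespace ShellStep

open Literature.Barriers.PneNP Literature.Combinatorics.SimpleGraph.CycleSpace

variable {n : ℕ}

/-- The partner map of a perfect matching is an involution. [cite: GodsilMeagher2015, §15.2] -/
theorem partner_partner (M : PMatch n) (v : Fin n) : M.2.partner (M.2.partner v) = v :=
  M.2.partner_partner v

/-- … without fixed points. [cite: GodsilMeagher2015, §15.2] -/
theorem partner_ne (M : PMatch n) (v : Fin n) : M.2.partner v ≠ v :=
  M.2.partner_ne v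

/-- **`cc(U,M) = |half(U)|`**: the crossing edges `δ(U) ∩ M` correspond to the vertices of `U` matched
outside `U`, `v ↦ {v, π v}`. [cite: Rothvoss2017, §2 (PDF p. 5)] -/
theorem cc_eq_card_half (U : OddSet n) (M : PMatch n) :
    cc U M = (half M.2.partner U.1).card := by
  classical
  unfold cc
  symm
  refine card_bij (fun v _ => s(v, M.2.partner v)) ?_ ?_ ?_
  · intro v hv
    obtain ⟨hvU, hπv⟩ := mem_half.1 hv
    exact mem_filter.2 ⟨M.2.mk_partner_mem v, (crosses_mk U.1 v _).2 (Or.inl ⟨hvU, hπv⟩)⟩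
  · intro v hv w hw h
    obtain ⟨hvU, _⟩ := mem_half.1 hv
    obtain ⟨_, hπw⟩ := mem_half.1 hw
    rcases Sym2.eq_iff.1 h with ⟨h1, _⟩ | ⟨h1, _⟩
    · exact h1
    · exact absurd (h1 ▸ hvU) hπw
  · intro e he
    obtain ⟨heM, hcr⟩ := mem_filter.1 he
    induction e using Sym2.ind with
    | h x y =>
      rcases (crosses_mk U.1 x y).1 hcr with ⟨hx, hy⟩ | ⟨hx, hy⟩
      · have hyx : y = M.2.partner x := M.2.eq_partner_of_mem heM
        exact ⟨x, mem_half.2 ⟨hx, hyx ▸ hy⟩, by rw [hyx]⟩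
      · have hxy : x = M.2.partner y := M.2.eq_partner_of_mem (by rw [Sym2.eq_swap]; exact heM)
        exact ⟨y, mem_half.2 ⟨hy, hxy ▸ hx⟩, by rw [← hxy, Sym2.eq_swap]⟩

/-- The shell of the tree's level class: `U ∈ Shell_c(M)` iff `|U| = t` and `cc(U,M) = c`.
[cite: Rothvoss2017, §2 (PDF p. 6)] -/
theorem mem_shell_partner_iff {t c : ℕ} (U : OddSet n) (M : PMatch n) :
    U.1 ∈ shell M.2.partner t c ↔ U.1.card = t ∧ cc U M = c := by
  rw [mem_shell, cc_eq_card_half]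

/-- **The shell-step identity for a perfect matching** `M` of `K_n` (`π` = its partner map):
`(c+2)(c+1) · Σ_{U′ : |U′| = t, cc = c+2} g(U′) = Σ_{U : |U| = t, cc = c} Σ_{b ∈ full(U)} Σ_{a ∈ free(U)} g(U − b + a)`.
[cite: Rothvoss2017, §2 (PDF p. 6)] -/
theorem shellStep_sum_partner (M : PMatch n) (t c : ℕ) (g : Finset (Fin n) → ℝ) :
    ((c + 2) * (c + 1) : ℝ) * ∑ U' ∈ shell M.2.partner t (c + 2), g U' =
      ∑ U ∈ shell M.2.partner t c, ∑ b ∈ full M.2.partner U, ∑ a ∈ free M.2.partner U,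
        g (move U b a) :=
  shellStep_sum (partner_partner M) (partner_ne M) t c g

/-- **Bi-regularity of Rothvoß's adjacent level classes at a fixed matching**:
`(c+2)(c+1) · #{U : |U| = t, cc(U,M) = c+2} = (t−c)(n−t−c) · #{U : |U| = t, cc(U,M) = c}`.
[cite: Rothvoss2017, §2 (PDF p. 6)] -/
theorem shellStep_card_partner (M : PMatch n) (t c : ℕ) :
    ((c + 2) * (c + 1) : ℝ) * (shell M.2.partner t (c + 2)).card =
      ((t - c) * (n - t - c) : ℝ) * (shell M.2.partner t c).card :=
  shellStep_card (partner_partner M) (partner_ne M) t c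

end ShellStep

end Literature.Combinatorics.Optimization

end
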